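import Summits.QuantumFields.YangMills.Theorems.UnitScaleTiltProp7NestedMeanTowerClosenessT3
import Summits.QuantumFields.YangMills.Theorems.UnitScaleTiltProp7NestedMeanBridge
import HarnessLib

/-!
# Route `UnitScaleTilt`, crux K1 child «MinimiserStabilityRegPr» (stmt-QuantumFields-19200), skeleton v10, stub `stub_existenceMinimalOrbit` (EX), route (α) —
# **R2a′-TOWER (ROW-T) ∘ ROW-B: THE PLUG.**  ★px20 g2's socket ✓`Prop7NestedMeanPoincare.normSq_toL2S_le_two_mul_of_ns_eq_zero` ∕ ✓`hPoinc_of_towerCloseness` displays the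
# tower-closeness data `C hC hC0 η hη hclose g hg η' hη' htop hwin`; part 2 (✓`…NestedMeanTowerClosenessT3`) inhabits every one of them at the corner-axial references from
# `RegPr F n K ε₀ U₀` + `10⁷L³ε₀ ≤ 1` (`η_j = 4500L²ε₀·Lʲη`, `η' = 0`).  This file performs the `exact`: **on `𝔘_k(ε₀)`, `ns_{K−n} l = 0 ⟹ ‖toL2S l‖² ≤ 2·‖D^η_{U₀}(toL2S l)‖²`
# with NO displayed row**, and the same in ★w5-20520 g7's `hPoinc` currency on the sector `Z`.

Cell `ym3-torus`, width seat `ym3-torus-px11` (gen 2).  THEOREMS ONLY (0 `def`, 0 `sorry`).  `--supports stmt-QuantumFields-19200 --as helper`, count-neutral.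
YM₃ on T³ is a ladder rung (R3), not the Clay problem; nothing here claims the stub, the crux, d = 4 or the gap.

WHAT IS PROVED (sorry-free, no definition): ★★★`normSq_toL2S_le_two_mul_of_nsTop_eq_zero` and ★★★`hPoinc_of_regPr` (the (hP)-Poincaré slot of the (P2-core) plan v2 modulo
(H-Z) only).  HONEST SCOPE: a composition of ✓ROW-B (★px20 g2) with ✓ROW-T parts 1–2; nothing of print asserted beyond their citations.

References: T. Bałaban, CMP **99** (1985) 389–434 [Balaban1985BackgroundPropagators] (Thm 3.11 p.416, (3.19) p.393); CMP **102** (1985) 277–309 [Balaban1985Variational]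
((2) p.278); CMP **98** (1985) 17–51 [Balaban1985Averaging] ((97) p.32, pp.24–25).
-/

set_option autoImplicit false

noncomputable section

open scoped BigOperators Matrix.Norms.L2Operator

namespace Summit.QuantumFields.YangMills.Theorems.Prop7NestedMeanTowerCloseness

open Literature.MathematicalPhysics.QuantumFieldTheory.Balaban1983to89
open Finset T4Continuum BlockAveraging
open B5Eq118OneStroke (iterBlockOf iterBlock)
open B15DeterminingSets (embIter)
open B7Prop1Explicit (U1 treeWord disp)
open B10Eq27TorusAxialLog (holT axialT transl unitsField toUField)
open B7TransferAnalyticMean (meanCLM)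
open T3ContinuumYM3Torus
open T3RegularMinimiser (regThreshold)
open T3PrintedRegularMinimiser (RegPr)
open T3SectALandauChart (eta eta_pos bgUnits)
open Summit.QuantumFields.YangMills.Theorems.Prop8Chart (emlIterU)
open Summit.QuantumFields.YangMills.Theorems.Prop7SectET3HilbertLetters (toL2S DL2)
open Summit.QuantumFields.YangMills.Theorems.Prop7SectET3GaugeProjector (NS)
open Summit.QuantumFields.YangMills.Theorems.Prop7NestedMeanPoincare (normSq_toL2S_le_two_mul_of_ns_eq_zero hPoinc_of_towerCloseness)

section Plug

variable (F : T3Family) {n K : ℕ}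

/-- ★★★ **ON `𝔘_k(ε₀)`, THE NESTED COVARIANT MEAN CONDITION GIVES THE BLOCK POINCARÉ INEQUALITY WITH NO DISPLAYED TOWER ROW**: `RegPr F n K ε₀ U₀`, `10⁷L³ε₀ ≤ 1`, `ns` the
averaging sequence of `l` against `Ū₀♭` (the `h0`∕`hsucc` of ✓`QTwS_gaugeDir_of_avgSeq` VERBATIM), `ns (K − n) = 0` ⟹ `‖toL2S l‖² ≤ 2·‖D^η_{U₀}(toL2S l)‖²` — ★px20 g2's ROW-B socket
with every row inhabited by ROW-T (corner-axial references, `η_j = 4500L²ε₀Lʲη`, `η' = 0`).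
[cite: Balaban1985BackgroundPropagators, Thm 3.11 p.416, (3.19) p.393; Balaban1985Averaging, (97) p.32; Balaban1985Variational, (2) p.278] -/
theorem normSq_toL2S_le_two_mul_of_nsTop_eq_zero {c₀ : ℝ} [Fact (0 < c₀)] {ε₀ : ℝ} (hε₀ : 0 < ε₀) (hε7 : 10 ^ 7 * (F.L : ℝ) ^ 3 * ε₀ ≤ 1)
    (U₀ : GaugeField (F.P K) 0 (Matrix.specialUnitaryGroup (Fin 2) ℂ)) (hreg : RegPr F n K ε₀ U₀)
    (ns : (j : ℕ) → Site (F.P K) j → Matrix (Fin 2) (Fin 2) ℂ) (l : Site (F.P K) 0 → Matrix (Fin 2) (Fin 2) ℂ) (h0 : ns 0 = l)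
    (hsucc : ∀ (j : ℕ) (y : Site (F.P K) (j + 1)), ns (j + 1) y = ns j (emb y) - meanCLM (Idx (F.P K)) (Matrix (Fin 2) (Fin 2) ℂ) fun i : Idx (F.P K) =>
        ns j (emb y) - ((holT (emlIterU j (bgUnits F K U₀)) (emb y) (stairWord i.2.1 (off i.1)) : (Matrix (Fin 2) (Fin 2) ℂ)ˣ) : Matrix (Fin 2) (Fin 2) ℂ) *
          ns j (transl (emb y) (disp (stairWord i.2.1 (off i.1)))) * (((holT (emlIterU j (bgUnits F K U₀)) (emb y) (stairWord i.2.1 (off i.1)))⁻¹ : (Matrix (Fin 2) (Fin 2) ℂ)ˣ) : Matrix (Fin 2) (Fin 2) ℂ))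
    (hker : ∀ y, ns (K - n) y = 0) :
    ‖toL2S F K c₀ l‖ ^ 2 ≤ 2 * ‖DL2 F n K c₀ U₀ (toL2S F K c₀ l)‖ ^ 2 :=
  normSq_toL2S_le_two_mul_of_ns_eq_zero F hε₀ hε7 U₀ hreg ns l h0 hsucc
    (fun j z x => (axialT (bgUnits F K U₀) (Site.fibreSite 0 (K - n) (iterBlockOf (K - n) x) fun _ => (⟨0, pow_pos (F.P K).L_pos (K - n)⟩ : Fin ((F.P K).L ^ (K - n))))
        (embIter j z))⁻¹ *
      axialT (bgUnits F K U₀) (Site.fibreSite 0 (K - n) (iterBlockOf (K - n) x) fun _ => (⟨0, pow_pos (F.P K).L_pos (K - n)⟩ : Fin ((F.P K).L ^ (K - n)))) x)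
    (fun j _ z x => ref_T3_mem_U1 F U₀ j z x) (fun x => ref_T3_zero_self F U₀ x)
    (fun j => 4500 * (F.L : ℝ) ^ 2 * ε₀ * ((F.L : ℝ) ^ j * eta F n K))
    (fun j => by have := hε₀.le; have := (eta_pos F n K).le; positivity)
    (hclose_T3 F hε₀ hε7 U₀ hreg.plaqSmall)
    (fun y => (axialT (bgUnits F K U₀) (Site.fibreSite 0 (K - n) y fun _ => (⟨0, pow_pos (F.P K).L_pos (K - n)⟩ : Fin ((F.P K).L ^ (K - n)))) (embIter (K - n) y))⁻¹)
    (fun y => g_T3_mem_U1 F U₀ y) (le_refl (0 : ℝ)) (htop_T3 F U₀) (window_T3 F hε₀ hε7) hker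

variable (h : n ≤ K)

/-- ★★★ **THE `hPoinc` ROW OF THE R2b″ ASSEMBLER ON THE SECTOR `Z`, FROM `RegPr` ALONE** (`P₂ = 2`): ★px20 g2's ✓`hPoinc_of_towerCloseness` with every tower-closeness row
inhabited by ROW-T. [cite: Balaban1985BackgroundPropagators, Thm 3.11 p.416, (3.19) p.393; Balaban1985Averaging, (97) p.32; Balaban1985Variational, (2) p.278] -/
theorem hPoinc_of_regPr {c₀ : ℝ} [Fact (0 < c₀)] (cB : ℝ) {ε₀ : ℝ} (hε₀ : 0 < ε₀) (hε7 : 10 ^ 7 * (F.L : ℝ) ^ 3 * ε₀ ≤ 1)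
    (U₀ : GaugeField (F.P K) 0 (Matrix.specialUnitaryGroup (Fin 2) ℂ)) (hreg : RegPr F n K ε₀ U₀) :
    ∀ l₁ : Site (F.P K) 0 → Matrix (Fin 2) (Fin 2) ℂ, toL2S F K c₀ l₁ ∈ NS F n K h c₀ cB U₀ →
      (∃ ns : (j : ℕ) → Site (F.P K) j → Matrix (Fin 2) (Fin 2) ℂ, ns 0 = l₁ ∧
        (∀ (j : ℕ) (y : Site (F.P K) (j + 1)), ns (j + 1) y = ns j (emb y) - meanCLM (Idx (F.P K)) (Matrix (Fin 2) (Fin 2) ℂ) fun i : Idx (F.P K) =>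
          ns j (emb y) - ((holT (emlIterU j (bgUnits F K U₀)) (emb y) (stairWord i.2.1 (off i.1)) : (Matrix (Fin 2) (Fin 2) ℂ)ˣ) : Matrix (Fin 2) (Fin 2) ℂ) *
            ns j (transl (emb y) (disp (stairWord i.2.1 (off i.1)))) * (((holT (emlIterU j (bgUnits F K U₀)) (emb y) (stairWord i.2.1 (off i.1)))⁻¹ : (Matrix (Fin 2) (Fin 2) ℂ)ˣ) : Matrix (Fin 2) (Fin 2) ℂ)) ∧
        ∀ y, ns (K - n) y = 0) →
      ‖toL2S F K c₀ l₁‖ ^ 2 ≤ 2 * ‖DL2 F n K c₀ U₀ (toL2S F K c₀ l₁)‖ ^ 2 := by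
  intro l₁ _ hZ
  obtain ⟨ns, h0, hsucc, hker⟩ := hZ
  exact normSq_toL2S_le_two_mul_of_nsTop_eq_zero F hε₀ hε7 U₀ hreg ns l₁ h0 hsucc hker

end Plug

end Summit.QuantumFields.YangMills.Theorems.Prop7NestedMeanTowerCloseness

end
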